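import Mathlib
import Summits.ValiantsHypothesis.ValiantsHypothesis.Theorems.NewtonUnitEquationsDissociatedUniformTotalsLawGeneral
import HarnessLib

/-!
# Crux `NewtonUnitEquations.DissociatedUniform` (stmt-ValiantsHypothesis-5905): general totals law — TOP LOCALITY
# (a class maximiser is coordinatewise optimal outside fewer than `|G|` coordinates; zero-sum-freeness of the slack shifts)

Model (Q**) with `n` coordinates over a finite abelian group `G` (`…TotalsLawGeneral`: class `s` = words `x : Fin n → G` with
`∑ x = s`, point `∑_j c_j(x_j)`).  Fix a weight `w`.  A coordinate `j` is SLACK for the word `x` if its letter `x_j` is not a maximiser of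
`u ↦ ⟨w, c_j u⟩`.  If `x` maximises `⟨w, ·⟩` over its class (in particular if its point is a hull vertex exposed by `w`), then:

* **`sum_shift_ne_zero_of_isClassMax`** (zero-sum-freeness): for every non-empty set `T` of slack coordinates and every choice of
  strictly better letters `u_j` (`j ∈ T`), the shifts `u_j − x_j` do NOT sum to `0` — otherwise the improved word lies in the same class
  and scores more;
* **`exists_zero_sum_block`** (Davenport bound `D(G) ≤ |G|` in its elementary form): among any `m ≥ |G|` group elements some non-empty
  consecutive block sums to `0` (pigeonhole on the `m + 1` prefix sums);
* **`card_slack_lt_card_of_isClassMax`**: hence a class maximiser has FEWER THAN `|G|` slack coordinates — every class top is the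
  coordinatewise-optimal word `x*(w)` repaired on `< |G|` coordinates.  For `G = ℤ/3` this is the "(≤ 2)-level" localisation named as the
  next rung of the general law in `Cruxes/DissociatedUniform/NOTES-t1g3.md` §4(i) (tops = `x*` with one letter shifted by `δ`, or two letters
  both shifted by `−δ`: `shifts_eq_of_two_slack` gives the equal-shift clause), the `q = 3` analogue of the static top-two lemma
  `Binary.top_mem_pairAt` behind the binary row.
Honest label: structural lemma (no count of tops along a chart yet — that needs the ≤2-level Davenport–Schinzel analysis of NOTES-t1g8 §4);
`TotalsLawGeneral C` OPEN; nothing here bears on VP ≠ VNP.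
[folklore: Davenport constant of a finite abelian group is at most its order]
-/

set_option linter.dupNamespace false -- `ValiantsHypothesis.ValiantsHypothesis` (summit = problem) in every name

open scoped BigOperators

namespace Summit.ValiantsHypothesis.ValiantsHypothesis.Theorems.NewtonUnitEquationsDissociatedUniform

namespace TotalsLawN

section TopLocality

variable {G : Type*} [AddCommGroup G] {n : ℕ}

omit [AddCommGroup G] in
/-- The score of a word at the weight `w`: `⟨w, ∑_j c_j(x_j)⟩ = ∑_j ⟨w, c_j(x_j)⟩`. [folklore] -/
theorem dotProduct_sum_eq (c : Fin n → G → (Fin 2 → ℝ)) (w : Fin 2 → ℝ) (x : Fin n → G) :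
    w ⬝ᵥ (∑ j, c j (x j)) = ∑ j, w ⬝ᵥ c j (x j) := by
  rw [dotProduct_comm, sum_dotProduct]
  exact Finset.sum_congr rfl fun j _ => dotProduct_comm _ _

/-- `x` is a CLASS MAXIMISER at `w`: every word of the same class scores at most as much. -/
def IsClassMax (c : Fin n → G → (Fin 2 → ℝ)) (w : Fin 2 → ℝ) (x : Fin n → G) : Prop :=
  ∀ x' : Fin n → G, ∑ j, x' j = ∑ j, x j → w ⬝ᵥ (∑ j, c j (x' j)) ≤ w ⬝ᵥ (∑ j, c j (x j))

/-- **Zero-sum-freeness of improving shifts.**  If `x` is a class maximiser at `w`, `T` a non-empty set of coordinates and `u` assigns to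
every `j ∈ T` a STRICTLY better letter (`⟨w, c_j(x_j)⟩ < ⟨w, c_j(u_j)⟩`), then `∑_{j∈T} (u_j − x_j) ≠ 0`. [folklore] -/
theorem sum_shift_ne_zero_of_isClassMax {c : Fin n → G → (Fin 2 → ℝ)} {w : Fin 2 → ℝ} {x : Fin n → G}
    (hx : IsClassMax c w x) {T : Finset (Fin n)} (hT : T.Nonempty) {u : Fin n → G}
    (hu : ∀ j ∈ T, w ⬝ᵥ c j (x j) < w ⬝ᵥ c j (u j)) : ∑ j ∈ T, (u j - x j) ≠ 0 := by
  classical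
  intro hzero
  -- the repaired word
  set x' : Fin n → G := fun j => if j ∈ T then u j else x j with hx'
  have hclass : ∑ j, x' j = ∑ j, x j := by
    have h1 : ∑ j, x' j = ∑ j, x j + ∑ j, (if j ∈ T then u j - x j else 0) := by
      rw [← Finset.sum_add_distrib]
      refine Finset.sum_congr rfl fun j _ => ?_
      by_cases hj : j ∈ T <;> simp [hx', hj]
    rw [h1, ← Finset.sum_filter, Finset.filter_mem_eq_inter, Finset.univ_inter, hzero, add_zero]
  have hle := hx x' hclass
  -- but the score strictly increases
  have hlt : w ⬝ᵥ (∑ j, c j (x j)) < w ⬝ᵥ (∑ j, c j (x' j)) := by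
    rw [dotProduct_sum_eq, dotProduct_sum_eq]
    have hterm : ∀ j ∈ (Finset.univ : Finset (Fin n)), w ⬝ᵥ c j (x j) ≤ w ⬝ᵥ c j (x' j) := by
      intro j _
      by_cases hj : j ∈ T
      · simp only [hx', hj, if_true]; exact (hu j hj).le
      · simp only [hx', hj, if_false]; exact le_rfl
    obtain ⟨j₀, hj₀⟩ := hT
    have hstrict : w ⬝ᵥ c j₀ (x j₀) < w ⬝ᵥ c j₀ (x' j₀) := by
      simp only [hx', hj₀, if_true]; exact hu j₀ hj₀
    exact Finset.sum_lt_sum hterm ⟨j₀, Finset.mem_univ _, hstrict⟩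
  exact absurd hle (not_le.2 hlt)

/-- **Zero-sum block** (the elementary Davenport bound): among `m ≥ |G|` elements of a finite abelian group some non-empty block of
consecutive ones sums to zero (two of the `m + 1` prefix sums coincide). [folklore] -/
theorem exists_zero_sum_block [Fintype G] {m : ℕ} (hm : Fintype.card G ≤ m) (δ : Fin m → G) :
    ∃ k l : ℕ, k < l ∧ l ≤ m ∧ ∑ i : Fin m with k ≤ i.val ∧ i.val < l, δ i = 0 := by
  classical
  -- prefix sums `P t = ∑_{i < t} δ i`, `t = 0, …, m`
  set P : Fin (m + 1) → G := fun t => ∑ i : Fin m with i.val < t.val, δ i with hP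
  have hcard : Fintype.card G < Fintype.card (Fin (m + 1)) := by rw [Fintype.card_fin]; omega
  obtain ⟨t₁, t₂, hne, heq⟩ := Fintype.exists_ne_map_eq_of_card_lt P hcard
  -- order the two indices
  have key : ∀ a b : Fin (m + 1), a.val < b.val → P a = P b →
      ∑ i : Fin m with a.val ≤ i.val ∧ i.val < b.val, δ i = 0 := by
    intro a b hab hPab
    have hsplit : ∑ i : Fin m with i.val < b.val, δ i =
        ∑ i : Fin m with i.val < a.val, δ i + ∑ i : Fin m with a.val ≤ i.val ∧ i.val < b.val, δ i := by
      rw [← Finset.sum_union]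
      · refine Finset.sum_congr ?_ fun _ _ => rfl
        ext i
        simp only [Finset.mem_filter, Finset.mem_univ, true_and, Finset.mem_union]
        omega
      · rw [Finset.disjoint_filter]
        intro i _ h1 h2
        omega
    have hPa : P a = ∑ i : Fin m with i.val < a.val, δ i := rfl
    have hPb : P b = ∑ i : Fin m with i.val < b.val, δ i := rfl
    rw [hPb, hsplit, ← hPa, hPab] at hPab
    -- hPab : P b = P b + block  (after rewriting)  ⇒ block = 0
    exact left_eq_add.1 hPab
  rcases lt_or_gt_of_ne (fun h => hne (Fin.ext h)) with h | h
  · exact ⟨t₁.val, t₂.val, h, by omega, key t₁ t₂ h heq⟩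
  · exact ⟨t₂.val, t₁.val, h, by omega, key t₂ t₁ h heq.symm⟩

/-- The SLACK coordinates of `x` at `w`: letters that are not coordinatewise maximisers. -/
noncomputable def slack [Fintype G] [DecidableEq G] (c : Fin n → G → (Fin 2 → ℝ)) (w : Fin 2 → ℝ) (x : Fin n → G) : Finset (Fin n) :=
  Finset.univ.filter fun j => ∃ u : G, w ⬝ᵥ c j (x j) < w ⬝ᵥ c j u

/-- **Top locality.**  A class maximiser at `w` has fewer than `|G|` slack coordinates: it is the coordinatewise-optimal word repaired
on `< |G|` letters. [folklore] -/
theorem card_slack_lt_card_of_isClassMax [Fintype G] [DecidableEq G] {c : Fin n → G → (Fin 2 → ℝ)} {w : Fin 2 → ℝ}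
    {x : Fin n → G} (hx : IsClassMax c w x) : (slack c w x).card < Fintype.card G := by
  classical
  by_contra hge
  rw [not_lt] at hge
  -- better letters on the slack coordinates
  have hchoice : ∀ j : Fin n, ∃ u : G, j ∈ slack c w x → w ⬝ᵥ c j (x j) < w ⬝ᵥ c j u := by
    intro j
    by_cases hj : j ∈ slack c w x
    · obtain ⟨u, hu⟩ := (Finset.mem_filter.1 hj).2
      exact ⟨u, fun _ => hu⟩
    · exact ⟨x j, fun h => absurd h hj⟩
  choose u hu using hchoice
  -- enumerate the slack set and find a zero-sum block of shifts
  set m := (slack c w x).card with hm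
  set e : Fin m → Fin n := fun i => ((slack c w x).equivFin.symm i).1 with he
  have he_mem : ∀ i, e i ∈ slack c w x := fun i => ((slack c w x).equivFin.symm i).2
  have he_inj : Function.Injective e := by
    intro i i' h
    exact (slack c w x).equivFin.symm.injective (Subtype.ext h)
  obtain ⟨k, l, hkl, hlm, hsum⟩ := exists_zero_sum_block hge fun i => u (e i) - x (e i)
  set B : Finset (Fin m) := Finset.univ.filter fun i : Fin m => k ≤ i.val ∧ i.val < l with hB
  set T : Finset (Fin n) := B.image e with hT
  have hTne : T.Nonempty := by
    refine ⟨e ⟨k, by omega⟩, Finset.mem_image.2 ⟨⟨k, by omega⟩, ?_, rfl⟩⟩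
    rw [hB, Finset.mem_filter]; exact ⟨Finset.mem_univ _, le_rfl, hkl⟩
  have hTsub : ∀ j ∈ T, j ∈ slack c w x := by
    intro j hj
    obtain ⟨i, -, rfl⟩ := Finset.mem_image.1 hj
    exact he_mem i
  have hTsum : ∑ j ∈ T, (u j - x j) = 0 := by
    rw [hT, Finset.sum_image fun i _ i' _ h => he_inj h]
    exact hsum
  exact sum_shift_ne_zero_of_isClassMax hx hTne (fun j hj => hu j (hTsub j hj)) hTsum

/-- **Two slack coordinates carry shifts with non-zero sum** (so over `ℤ/3` they are EQUAL): the pair version of zero-sum-freeness.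
[folklore] -/
theorem sum_two_shifts_ne_zero {c : Fin n → G → (Fin 2 → ℝ)} {w : Fin 2 → ℝ} {x : Fin n → G} (hx : IsClassMax c w x)
    {j j' : Fin n} (hjj' : j ≠ j') {u u' : G} (hu : w ⬝ᵥ c j (x j) < w ⬝ᵥ c j u) (hu' : w ⬝ᵥ c j' (x j') < w ⬝ᵥ c j' u') :
    (u - x j) + (u' - x j') ≠ 0 := by
  classical
  set v : Fin n → G := fun i => if i = j then u else u' with hv
  have h := sum_shift_ne_zero_of_isClassMax hx (T := {j, j'}) ⟨j, by simp⟩ (u := v) (by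
    intro i hi
    rcases Finset.mem_insert.1 hi with rfl | hi
    · simpa [hv] using hu
    · rw [Finset.mem_singleton] at hi; subst hi
      simpa [hv, hjj'.symm] using hu')
  rwa [Finset.sum_pair hjj', show v j = u by simp [hv], show v j' = u' by simp [hv, hjj'.symm]] at h

/-- A single slack coordinate carries a NON-ZERO shift to any better letter (trivial but recorded: the better letter differs).
[folklore] -/
theorem shift_ne_zero {c : Fin n → G → (Fin 2 → ℝ)} {w : Fin 2 → ℝ} {x : Fin n → G} {j : Fin n} {u : G}
    (hu : w ⬝ᵥ c j (x j) < w ⬝ᵥ c j u) : u - x j ≠ 0 := by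
  intro h
  rw [sub_eq_zero] at h
  rw [h] at hu
  exact lt_irrefl _ hu

/-- **`ℤ/3`: two slack coordinates are shifted by the same amount** (their shifts are non-zero with non-zero sum). [folklore] -/
theorem shifts_eq_of_two_slack {c : Fin n → ZMod 3 → (Fin 2 → ℝ)} {w : Fin 2 → ℝ} {x : Fin n → ZMod 3} (hx : IsClassMax c w x)
    {j j' : Fin n} (hjj' : j ≠ j') {u u' : ZMod 3} (hu : w ⬝ᵥ c j (x j) < w ⬝ᵥ c j u)
    (hu' : w ⬝ᵥ c j' (x j') < w ⬝ᵥ c j' u') : u - x j = u' - x j' := by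
  have h1 := shift_ne_zero hu
  have h2 := shift_ne_zero hu'
  have h3 := sum_two_shifts_ne_zero hx hjj' hu hu'
  generalize u - x j = d at h1 h3
  generalize u' - x j' = d' at h2 h3
  revert d d'
  decide

/-- **Hull vertices are class maximisers**: a word whose point is a hull vertex of the class maximises SOME non-trivial weight over the
class (exposure, `KPTT.exists_isStrictTop_of_mem_extremePoints`), so top locality applies to every vertex. [folklore] -/
theorem exists_isClassMax_of_mem_extremePoints [Fintype G] [DecidableEq G] (c : Fin n → G → (Fin 2 → ℝ)) {x : Fin n → G}
    (hx : (∑ j, c j (x j)) ∈ (convexHull ℝ (classPts c (∑ j, x j))).extremePoints ℝ) :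
    ∃ w : Fin 2 → ℝ, IsClassMax c w x ∧
      ∀ x' : Fin n → G, ∑ j, x' j = ∑ j, x j → (∑ j, c j (x' j)) ≠ (∑ j, c j (x j)) →
        w ⬝ᵥ (∑ j, c j (x' j)) < w ⬝ᵥ (∑ j, c j (x j)) := by
  classical
  set s := ∑ j, x j with hs
  set F : Finset (Fin 2 → ℝ) := Finset.univ.image fun y : {y : Fin n → G // ∑ j, y j = s} => ∑ j, c j (y.1 j) with hF
  have hcoe : (F : Set (Fin 2 → ℝ)) = classPts c s := by
    rw [hF, Finset.coe_image, Finset.coe_univ, Set.image_univ]; rfl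
  rw [← hcoe] at hx
  obtain ⟨w, hw⟩ := Literature.Computability.AlgebraicComplexity.KPTT.PlanarMinkowski.exists_isStrictTop_of_mem_extremePoints hx
  have hmem : ∀ x' : Fin n → G, ∑ j, x' j = s → (∑ j, c j (x' j)) ∈ F := fun x' hx' =>
    Finset.mem_image.2 ⟨⟨x', hx'⟩, Finset.mem_univ _, rfl⟩
  refine ⟨w, fun x' hx' => hw.le (hmem x' hx'), fun x' hx' hne => hw.lt (hmem x' hx') hne⟩

end TopLocality

end TotalsLawN

end Summit.ValiantsHypothesis.ValiantsHypothesis.Theorems.NewtonUnitEquationsDissociatedUniform
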